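import Summits.BirchSwinnertonDyer.BirchSwinnertonDyer.Theorems.TwoAdicConverseOrdLambdaHalfAtTwoBDPTwoVariableDefs
import HarnessLib

/-!
# Crux `BDPSelmerLowerDivisibilityAtTwo` (O2, stmt-BirchSwinnertonDyer-24728; route `TwoAdicConverse`, rung S3) —
# crux-idea NODE `cyclotomic-shadow-two` (planner `cruxidea-…-24728-1`, GEN 7, lens wuc@consumer-seam)

**The node in one sentence.**  O2 is consumed ONLY through the parent seam `O1 ∧ O2 → 6‴`
(`thetaShapiroGreenbergDivisibilityAtTwo_of_bdp`), and 6‴ (`ThetaDivisibilityAt W K`: `S.gD ≤ λ(X_Gr(E/K^cyc_∞))`)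
lives on the CYCLOTOMIC LINE in `λ`-currency.  So the consumer needs from the two-variable Greenberg side not the
integral inclusion `ch(X_Gr₂)·Λ^ur ⊆ (G)` (O2) but only its CYCLOTOMIC `λ`-SHADOW

  O2′ `GreenbergCycShadowAt W K`:  at every cyclotomically adapted frame (`κ₁` cyclotomic), with `C` a generator of
  `ch_{Λ_K}(X_Gr(E/K̃_∞))`:  `sh(C^J) ≠ 0`, `sh(G) ≠ 0` and `ord_T sh(G) ≤ ord_T sh(C^J)` in `𝔽̄₂⟦T⟧`,

where `sh = (kill the inner variable T₂ ↔ γ₂) ∘ (reduce mod 𝔪_{𝒪_{ℂ₂}})` is the cyclotomic shadow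
`𝒪_{ℂ₂}⟦T₁,T₂⟧ → 𝔽̄₂⟦T₁⟧` and `ord_T` is the `T`-adic order (= the classical `λ` of the cyclotomic restriction once its
`μ` vanishes).  The point: O2′ follows from the RESIDUAL two-variable equality `(red G) = (red C^J)` in the regular
2-dimensional domain `𝔽̄₂⟦T₁,T₂⟧` (v4's `Rres`, where finite = pseudo-null is invisible, so the equality is EXACT)
plus the object/torsion half `R0T` plus the cyclotomic non-degeneracy `N` (`sh(C^J) ≠ 0`, i.e. `μ = 0` for the
cyclotomic restriction — Ferrero–Washington level GL(1) input at `2`), with NO upper inclusion: the Euler-system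
divisibility U (= Beilinson–Flach at `2`, the located wall of GEN 6's census), the `∀`-line finiteness, the
anticyclotomic `μ = 0` of ACPIN, Gauss rigidity S and the frame's `2`-power normalisation all leave the critical path,
because an equality of residual divisors restricts to the line `T₂ = 0` as an equality of `T₁`-orders (a ring map
preserves associatedness; units have order `0`).

Kernel content of this file (no `sorry`): the two commutative-algebra levers (`§2`), the seams
O2 ∧ N ⟹ O2′ (so O2′ is WEAKER than O2 given N), R0T ∧ Rres ∧ N ⟹ O2′ (U-free), and the consumer resplit
O1′ ∧ O2′ ⟹ 6‴ with the cost link O1′ ∧ N ⟹ O1 (`§4`).  Research pieces are `Prop`s, nothing is asserted; BSD is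
proved for no curve here; typed ≠ proved.

References: Greenberg–Vatsal, Invent. Math. 142 (2000) §1 (residual comparison of `λ` under `μ = 0`)
[GreenbergVatsal2000]; Yan–Zhu arXiv:2412.20078v4 Thm. 4.2 (2), Thm. 4.7 [YanZhu2024MainConjNonCM];
Burungale–Castella–Skinner arXiv:2405.00270v2 Conj. 4.1.2, Thm. 4.1.3 [BurungaleCastellaSkinner2025];
Ferrero–Washington, Ann. of Math. 109 (1979) (abelian base, all `p` incl. `2`) [FerreroWashington1979];
de Shalit 1987 II.4.12–4.17 [deShalit1987]; Washington GTM 83 §13.2–13.4 [Washington1997]; cell records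
`Cruxes/BDPSelmerLowerDivisibilityAtTwo/CENSUS-r1-1.md` (GEN 2, recommendation (4) «recut to the cyclotomic line with
NONDEG(cyc)»), `CENSUS-r1-1-g6.md` (U-wall O-c/O-d), `Cruxes/OrdLambdaHalfAtTwo/PICKED.md` (v5 VERDICT, v6).
-/

set_option linter.dupNamespace false
set_option autoImplicit false

noncomputable section

open scoped Classical NumberField
open WeierstrassCurve NumberField IsDedekindDomain Field CategoryTheory Function PowerSeries CongruenceSubgroup
open Literature.NumberTheory.EllipticCurves Literature.NumberTheory.EllipticCurves.Rank1Residual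
open Literature.NumberTheory.EllipticCurves.ModularForms
open Literature.NumberTheory.GaloisRepresentations
open Literature.NumberTheory.EllipticCurves.IwasawaAlgebra₂ Literature.NumberTheory.EllipticCurves.UnrSeries₂
open Literature.NumberTheory.EllipticCurves.YanZhu2026
open Summit.BirchSwinnertonDyer.BirchSwinnertonDyer.Theorems.TwoAdicKatoDeterminant

namespace Summit.BirchSwinnertonDyer.BirchSwinnertonDyer.Cruxes.BDPSelmerLowerDivisibilityAtTwo.CyclotomicShadowTwo

/-! ## §1 The rings and the cyclotomic shadow -/

/-- `𝒪_{ℂ₂}⟦T₁,T₂⟧ = (𝒪_{ℂ₂}⟦T₂⟧)⟦T₁⟧` — home of `G`, `LK` and of `C^J = toUnr₂ 2 J C` (inner variable `T₂ ↔ γ₂`,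
outer `T₁ ↔ γ₁`, as in `IwasawaAlgebra₂ 2 = (ℤ₂⟦T₂⟧)⟦T₁⟧`). -/
abbrev A₂ : Type := PowerSeries (PowerSeries (PadicComplexInt 2))

/-- The residual two-variable algebra `𝔽̄₂⟦T₁,T₂⟧` (a regular 2-dimensional domain). -/
abbrev Ω₂ : Type := PowerSeries (PowerSeries (IsLocalRing.ResidueField (PadicComplexInt 2)))

/-- The residual ONE-variable algebra `𝔽̄₂⟦T₁⟧` of the `κ₁`-line — home of the cyclotomic shadows. -/
abbrev Ω₁ : Type := PowerSeries (IsLocalRing.ResidueField (PadicComplexInt 2))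

/-- Coefficientwise reduction `𝒪_{ℂ₂}⟦T₁,T₂⟧ → 𝔽̄₂⟦T₁,T₂⟧` (mod the maximal ideal of `𝒪_{ℂ₂}`). -/
def red₂ : A₂ →+* Ω₂ := PowerSeries.map (PowerSeries.map (IsLocalRing.residue (PadicComplexInt 2)))

/-- Restriction of a residual series to the `κ₁`-line: kill the INNER variable (`T₂ = 0`, i.e. `γ₂ ↦ 1`; `γ₂` fixes
`K_∞^{κ₁}` by `IsTopGeneratorPair`). -/
def line₁ : Ω₂ →+* Ω₁ :=
  PowerSeries.map (PowerSeries.constantCoeff (R := IsLocalRing.ResidueField (PadicComplexInt 2)))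

/-- **The cyclotomic shadow** `sh : 𝒪_{ℂ₂}⟦T₁,T₂⟧ → 𝔽̄₂⟦T₁⟧`: reduce, then restrict to the `κ₁`-line.  For a
cyclotomically adapted frame (`κ₁` cyclotomic) `ord_T (sh F)` is the `λ`-invariant of `F|_{K^cyc}` as soon as
`sh F ≠ 0` (i.e. `μ(F|_{K^cyc}) = 0`). -/
def shadow : A₂ →+* Ω₁ := line₁.comp red₂

theorem shadow_apply (F : A₂) : shadow F = line₁ (red₂ F) := rfl

/-! ## §2 The two commutative-algebra levers (kernel) -/

/-- **Lever 1 (divisibility ⇒ shadow inequality).**  If `(x) ⊆ (g)` in `𝒪_{ℂ₂}⟦T₁,T₂⟧` and the shadow of `x` is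
non-zero, then the shadow of `g` is non-zero and `ord_T sh(g) ≤ ord_T sh(x)`.  (This is why O2 ∧ N ⟹ O2′.) -/
theorem shadow_ne_zero_and_order_le_of_span_le {x g : A₂} (hle : Ideal.span {x} ≤ Ideal.span {g})
    (hx : shadow x ≠ 0) : shadow g ≠ 0 ∧ (shadow g).order ≤ (shadow x).order := by
  have hmem : x ∈ Ideal.span {g} := hle (Ideal.mem_span_singleton_self x)
  obtain ⟨a, ha⟩ := Ideal.mem_span_singleton'.mp hmem
  have hsx : shadow x = shadow a * shadow g := by rw [← ha, map_mul]
  refine ⟨?_, ?_⟩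
  · intro hg
    apply hx
    rw [hsx, hg, mul_zero]
  · rw [hsx]
    exact le_trans le_add_self (PowerSeries.le_order_mul _ _)

/-- **Lever 2 (residual divisor equality ⇒ shadow equality).**  If `(red g) = (red x)` as ideals of the DOMAIN
`𝔽̄₂⟦T₁,T₂⟧` and the shadow of `x` is non-zero, then the shadow of `g` is non-zero and the two shadows have the
SAME `T`-order: associated elements stay associated under the ring map `line₁`, and units of `𝔽̄₂⟦T⟧` have order
`0`.  (This is why R0T ∧ Rres ∧ N ⟹ O2′ with equality — no upper inclusion, no rigidity, no `2`-power frame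
normalisation: all of those are invisible residually or cancel in an equality of divisors.) -/
theorem shadow_ne_zero_and_order_eq_of_span_red_eq {g x : A₂}
    (heq : Ideal.span {red₂ g} = Ideal.span {red₂ x}) (hx : shadow x ≠ 0) :
    shadow g ≠ 0 ∧ (shadow g).order = (shadow x).order := by
  have hass : Associated (red₂ g) (red₂ x) := Ideal.span_singleton_eq_span_singleton.mp heq
  obtain ⟨u, hu⟩ := hass
  have hunit : IsUnit (line₁ (u : Ω₂)) := u.isUnit.map line₁
  have h1 : shadow x = shadow g * line₁ (u : Ω₂) := by
    rw [shadow_apply, shadow_apply, ← hu, map_mul]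
  refine ⟨?_, ?_⟩
  · intro h0
    apply hx
    rw [h1, h0, zero_mul]
  · rw [h1, PowerSeries.order_mul, PowerSeries.order_zero_of_unit hunit, add_zero]

/-! ## §3 The pieces (Props; nothing asserted)

`R0T` and `Rres` are RE-DECLARED character for character from the registered O2 line
`Cruxes/OrdLambdaHalfAtTwo/Lines/kato_determinant_greenberg_two_O2_gv_squeeze_v4.lean` (same decl names, so the
lead's census applies verbatim); `N`, O2′ and O1′ are new. -/

/-- **R0T at `(E,K)`** (v4, verbatim) — OBJECT half: an admissible frame `(Ω, δ, Ωp, LK, G)` exists at `2` (`LK` IS the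
Katz measure — in print at `2`, de Shalit II.4.12/4.14; `G` IS `𝓛_2^Gr(E/K)` — UNPRINTED at `2`) and `X_Gr(E/K̃_∞)` is
`Λ_K`-torsion (⟸ one finite double layer, tree `TwoAdicBDPLineLift`). [cite: deShalit1987, II.4.12–4.17]
[cite: YanZhu2024MainConjNonCM, Def. 3.11] -/
def GreenbergFrameTorsionAt (W : WeierstrassCurve ℚ) [W.IsElliptic] [W.IsGloballyMinimal]
    (K : Type) [Field K] [NumberField K] : Prop :=
  ∀ [IsCMField K] (ι : PadicAlgCl 2 ≃+* ℂ) (v vbar : HeightOneSpectrum (𝓞 K)) (κ₁ κ₂ : ZpExtension K 2)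
    (γ₁ γ₂ : absoluteGaloisGroup K) [Fact (ZpExtension.IsTopGeneratorPair κ₁ κ₂ γ₁ γ₂)]
    [NeZero (W.conductorNorm ℤ)] (f : CuspForm (Gamma0 (W.conductorNorm ℤ)) 2),
    ModularForms.IsNewformOf W f → ∀ [NeZero (NumberField.discr K).natAbs],
    ((2 : ℕ) : 𝓞 K) ∈ v.asIdeal → ((2 : ℕ) : 𝓞 K) ∈ vbar.asIdeal → vbar ≠ v →
    (∀ (w : InfinitePlace K) (k : 𝓞 K), k ∈ v.asIdeal ↔ ‖ι.symm (w.embedding (k : K))‖ < 1) →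
    ∃ (Ω δ : ℂ) (Ωp : (unrIntegers 2)ˣ) (LK G : A₂),
      Ω ≠ 0 ∧ (δ ^ 2 = (NumberField.discr K : ℂ) ∨ δ ^ 2 = -(NumberField.discr K : ℂ)) ∧
      IsKatzMeasure₂ ι v vbar ∅ κ₁ κ₂ γ₁⁻¹ γ₂⁻¹ 1 Ω δ ((Ωp : unrIntegers 2) : ℂ_[2]) LK ∧
      IsGreenbergLFunctionFree₂ ι v vbar κ₁ κ₂ γ₁⁻¹ γ₂⁻¹ f (NumberField.discr K).natAbs
        (NumberField.classNumber K) LK G ∧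
      Module.IsTorsion (IwasawaAlgebra₂ 2) ((W.baseChange K).XGr₂ 2 κ₁ κ₂ vbar γ₁ γ₂)

/-- **Rres at `(E,K)`** (v4, verbatim) — RESIDUAL half, for EVERY admissible frame: `μ = 0` for `ch(X_Gr)` read in
`𝒪_{ℂ₂}⟦T₁,T₂⟧` and the residual divisor equality `(red G) = (red C^J)` in `𝔽̄₂⟦T₁,T₂⟧` (Greenberg–Vatsal two ways:
algebraic two-variable dévissage of `E[2]|_{G_K}` into trivial pieces + the equivariant GL(1)/K main conjecture at `2`
+ the CM-side congruence of measures `G ≡ LK·LK^†` mod `𝔪`). [cite: GreenbergVatsal2000, §1, Thm. 1.3]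
[cite: deShalit1987, III.1.10, II.4.12] -/
def GreenbergResidualEqualityForallAt (W : WeierstrassCurve ℚ) [W.IsElliptic] [W.IsGloballyMinimal]
    (K : Type) [Field K] [NumberField K] : Prop :=
  ∀ [IsCMField K] (ι : PadicAlgCl 2 ≃+* ℂ) (v vbar : HeightOneSpectrum (𝓞 K)) (κ₁ κ₂ : ZpExtension K 2)
    (γ₁ γ₂ : absoluteGaloisGroup K) [Fact (ZpExtension.IsTopGeneratorPair κ₁ κ₂ γ₁ γ₂)]
    [NeZero (W.conductorNorm ℤ)] (f : CuspForm (Gamma0 (W.conductorNorm ℤ)) 2),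
    ModularForms.IsNewformOf W f → ∀ [NeZero (NumberField.discr K).natAbs],
    ((2 : ℕ) : 𝓞 K) ∈ v.asIdeal → ((2 : ℕ) : 𝓞 K) ∈ vbar.asIdeal → vbar ≠ v →
    (∀ (w : InfinitePlace K) (k : 𝓞 K), k ∈ v.asIdeal ↔ ‖ι.symm (w.embedding (k : K))‖ < 1) →
    ∀ (Ω δ : ℂ) (Ωp : (unrIntegers 2)ˣ) (LK G : A₂),
      Ω ≠ 0 → (δ ^ 2 = (NumberField.discr K : ℂ) ∨ δ ^ 2 = -(NumberField.discr K : ℂ)) →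
      IsKatzMeasure₂ ι v vbar ∅ κ₁ κ₂ γ₁⁻¹ γ₂⁻¹ 1 Ω δ ((Ωp : unrIntegers 2) : ℂ_[2]) LK →
      IsGreenbergLFunctionFree₂ ι v vbar κ₁ κ₂ γ₁⁻¹ γ₂⁻¹ f (NumberField.discr K).natAbs
        (NumberField.classNumber K) LK G →
      ∀ J : ℤ_[2] →+* PadicComplexInt 2,
        (∀ x : ℤ_[2], ((J x : PadicComplexInt 2) : ℂ_[2]) = ((x : ℚ_[2]) : ℂ_[2])) →
        ∀ C : IwasawaAlgebra₂ 2,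
          WeierstrassCurve.XGr₂.charIdeal (W.baseChange K) 2 κ₁ κ₂ vbar γ₁ γ₂ = Ideal.span {C} →
          red₂ (toUnr₂ 2 J C) ≠ 0 ∧ Ideal.span {red₂ G} = Ideal.span {red₂ (toUnr₂ 2 J C)}

/-- **N at `(E,K)` — cyclotomic non-degeneracy of the algebraic side** (NEW; GL(1)-grade at `2`): at every
CYCLOTOMICALLY adapted frame (`κ₁` cyclotomic, so `T₂ = 0` is the line `K^cyc_∞`) every generator `C` of
`ch_{Λ_K}(X_Gr(E/K̃_∞))` has non-zero cyclotomic shadow, i.e. `C ∉ (2, T₂)`: `μ(ch(X_Gr)|_{K^cyc}) = 0`.  Reduction: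
`X_Gr/(2,T₂)X_Gr` finite ⟹ `ch(X_Gr) ⊄ (2,T₂)` (kernel, the height-2 twin of the landed
`TwoAdicBDPLineLift.not_charIdeal_le_of_smul_eq_zero_of_notMem`), and the finiteness ⟸ control to `K^cyc_∞` + the
dévissage of `E[2^∞]|_{G_K}` (every `𝔽₂^×`-character trivial) + Ferrero–Washington for the abelian field `K^cyc_n`
at `p = 2` + Iwasawa–Gillard (semi-local units mod cyclotomic units at `ℓ = 2`, `μ = 0`).  WHY IT MIGHT FAIL: a
`μ`-leak of the pseudo-null defect onto the special line `T₂ = 0` (control at `2` on branch (β) has finite but non-zero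
local terms at `v̄`), or `μ(X_Gr(E/K^cyc_∞)) > 0` after all (Greenberg's `μ > 0` examples at `2` are over `ℚ` for the
ORDINARY condition with `E[2] ⊄` the kernel of reduction — to be audited for the Greenberg condition `(∅ at v, 0 at v̄)`).
[cite: FerreroWashington1979, main theorem (p = 2 included)] [cite: Washington1997, Thm. 7.15, §13.3]
[cite: GreenbergVatsal2000, §1] -/
def GreenbergCycNondegAt (W : WeierstrassCurve ℚ) [W.IsElliptic] [W.IsGloballyMinimal]
    (K : Type) [Field K] [NumberField K] : Prop :=
  ∀ (vbar : HeightOneSpectrum (𝓞 K)) (κ₁ κ₂ : ZpExtension K 2) (γ₁ γ₂ : absoluteGaloisGroup K)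
    [Fact (ZpExtension.IsTopGeneratorPair κ₁ κ₂ γ₁ γ₂)],
    κ₁.IsCyclotomic → ((2 : ℕ) : 𝓞 K) ∈ vbar.asIdeal →
    ∀ (J : ℤ_[2] →+* PadicComplexInt 2) (C : IwasawaAlgebra₂ 2),
      WeierstrassCurve.XGr₂.charIdeal (W.baseChange K) 2 κ₁ κ₂ vbar γ₁ γ₂ = Ideal.span {C} →
      shadow (toUnr₂ 2 J C) ≠ 0

/-- **O2′ at `(E,K)` — the CYCLOTOMIC `λ`-SHADOW of O2** (NEW; the proposed replacement of O2 in the parent seam):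
O2's binders with the frame restricted to CYCLOTOMICALLY adapted pairs (`κ₁` cyclotomic), O2's `∃`-frame and torsion
conjunct unchanged, and O2's integral inclusion `ch(X_Gr)·Λ^ur ⊆ (G)` replaced by its shadow on the line `T₂ = 0`:
for every generator `C` of `ch(X_Gr)`, `sh(C^J) ≠ 0`, `sh(G) ≠ 0` and `ord_T sh(G) ≤ ord_T sh(C^J)` in `𝔽̄₂⟦T⟧`
(`λ_cyc(𝓛_2^Gr) ≤ λ_cyc(ch X_Gr)` with both cyclotomic `μ`'s zero).  WEAKER than O2 given N (`§4`
`cycShadowAt_of_lowerInclusionAt`); implied by R0T ∧ Rres ∧ N with EQUALITY (`cycShadowAt_of_residualEquality`).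
WHY IT MIGHT FAIL: exactly where R0T (the object `G` at `2`), Rres (the CM-side measure congruence at `2`) or N fail;
it does NOT fail where O2 may (an integral `2`-power discrepancy `ch ⊄ (G)` with correct residual divisors is invisible
to O2′). [cite: GreenbergVatsal2000, §1, Thm. 1.3] [cite: YanZhu2024MainConjNonCM, Thm. 4.2 (2)]
[cite: BurungaleCastellaSkinner2025, Conj. 4.1.2] -/
def GreenbergCycShadowAt (W : WeierstrassCurve ℚ) [W.IsElliptic] [W.IsGloballyMinimal]
    (K : Type) [Field K] [NumberField K] : Prop :=
  ∀ [IsCMField K] (ι : PadicAlgCl 2 ≃+* ℂ) (v vbar : HeightOneSpectrum (𝓞 K)) (κ₁ κ₂ : ZpExtension K 2)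
    (γ₁ γ₂ : absoluteGaloisGroup K) [Fact (ZpExtension.IsTopGeneratorPair κ₁ κ₂ γ₁ γ₂)]
    [NeZero (W.conductorNorm ℤ)] (f : CuspForm (Gamma0 (W.conductorNorm ℤ)) 2),
    ModularForms.IsNewformOf W f → ∀ [NeZero (NumberField.discr K).natAbs],
    ((2 : ℕ) : 𝓞 K) ∈ v.asIdeal → ((2 : ℕ) : 𝓞 K) ∈ vbar.asIdeal → vbar ≠ v →
    (∀ (w : InfinitePlace K) (k : 𝓞 K), k ∈ v.asIdeal ↔ ‖ι.symm (w.embedding (k : K))‖ < 1) →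
    κ₁.IsCyclotomic →
    ∃ (Ω δ : ℂ) (Ωp : (unrIntegers 2)ˣ) (LK G : A₂),
      Ω ≠ 0 ∧ (δ ^ 2 = (NumberField.discr K : ℂ) ∨ δ ^ 2 = -(NumberField.discr K : ℂ)) ∧
      IsKatzMeasure₂ ι v vbar ∅ κ₁ κ₂ γ₁⁻¹ γ₂⁻¹ 1 Ω δ ((Ωp : unrIntegers 2) : ℂ_[2]) LK ∧
      IsGreenbergLFunctionFree₂ ι v vbar κ₁ κ₂ γ₁⁻¹ γ₂⁻¹ f (NumberField.discr K).natAbs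
        (NumberField.classNumber K) LK G ∧
      Module.IsTorsion (IwasawaAlgebra₂ 2) ((W.baseChange K).XGr₂ 2 κ₁ κ₂ vbar γ₁ γ₂) ∧
      ∀ J : ℤ_[2] →+* PadicComplexInt 2,
        (∀ x : ℤ_[2], ((J x : PadicComplexInt 2) : ℂ_[2]) = ((x : ℚ_[2]) : ℂ_[2])) →
        ∀ C : IwasawaAlgebra₂ 2,
          WeierstrassCurve.XGr₂.charIdeal (W.baseChange K) 2 κ₁ κ₂ vbar γ₁ γ₂ = Ideal.span {C} →
          shadow (toUnr₂ 2 J C) ≠ 0 ∧ shadow G ≠ 0 ∧ (shadow G).order ≤ (shadow (toUnr₂ 2 J C)).order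

/-! ### The pieces on the habitat (β) of O2 -/

/-- O2′ on the habitat of O2: the proposed REPLACEMENT of `BDPSelmerLowerDivisibilityAtTwo` in the parent seam. -/
def CycShadowLowerAtTwo : Prop :=
  ∀ (W : WeierstrassCurve ℚ) [W.IsElliptic] [W.IsGloballyMinimal],
    ¬ W.HasCM → GoodOrd W 2 → ¬ W.HasIrreducibleModPGaloisRep 2 →
    ∀ (K : Type) [Field K] [NumberField K],
      (IsImaginaryQuadratic K ∧ SatisfiesHeegnerHypothesis (2 * W.conductorNorm ℤ) K) →
      GreenbergCycShadowAt W K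

/-- N on the habitat of O2. -/
def CycNondegAtTwo : Prop :=
  ∀ (W : WeierstrassCurve ℚ) [W.IsElliptic] [W.IsGloballyMinimal],
    ¬ W.HasCM → GoodOrd W 2 → ¬ W.HasIrreducibleModPGaloisRep 2 →
    ∀ (K : Type) [Field K] [NumberField K],
      (IsImaginaryQuadratic K ∧ SatisfiesHeegnerHypothesis (2 * W.conductorNorm ℤ) K) →
      GreenbergCycNondegAt W K

/-- R0T on the habitat of O2 (v4 shape). -/
def TwoVariableFrameTorsionAtTwo : Prop :=
  ∀ (W : WeierstrassCurve ℚ) [W.IsElliptic] [W.IsGloballyMinimal],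
    ¬ W.HasCM → GoodOrd W 2 → ¬ W.HasIrreducibleModPGaloisRep 2 →
    ∀ (K : Type) [Field K] [NumberField K],
      (IsImaginaryQuadratic K ∧ SatisfiesHeegnerHypothesis (2 * W.conductorNorm ℤ) K) →
      GreenbergFrameTorsionAt W K

/-- Rres on the habitat of O2 (v4 shape). -/
def TwoVariableResidualEqualityForallAtTwo : Prop :=
  ∀ (W : WeierstrassCurve ℚ) [W.IsElliptic] [W.IsGloballyMinimal],
    ¬ W.HasCM → GoodOrd W 2 → ¬ W.HasIrreducibleModPGaloisRep 2 →
    ∀ (K : Type) [Field K] [NumberField K],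
      (IsImaginaryQuadratic K ∧ SatisfiesHeegnerHypothesis (2 * W.conductorNorm ℤ) K) →
      GreenbergResidualEqualityForallAt W K

/-- **O1′ `SplitTwoERLCycShadow`** (NEW; the proposed replacement of O1 = item 24727 in the parent seam): the
datum-level bridge «cyclotomic `λ`-shadow of the Greenberg side ⟹ 6‴ at `(E,K)`».  Content: O1's explicit
reciprocity law at the split prime read in `λ`-currency on `K^cyc_∞` (`gD` versus `ord_T sh(G)`: the ERL + the
interpolation comparison `𝓛^Gr|_cyc ∼ 𝓛^PR|_cyc ∼ L₂(E)L₂(E^K)` up to residual UNITS and powers of `2`, which the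
shadow does not see) and the LOWER-direction descent `ord_T sh(C) ≤ λ(X_Gr(E/K^cyc_∞))` (control `K̃_∞ → K^cyc_∞`;
in the lower direction the pseudo-null submodule only enlarges `X_Gr₂/T₂` and the local coinvariants
`E[2^∞](K̃_w)_{γ_ac}` at `w ∣ v̄` vanish because the unramified character `α` is non-trivial — finite defects, no
`λ`-loss).  WHY IT MIGHT FAIL: as O1 (ERL at `2` with `E[2]` reducible: `2`-torsion in `H¹_Iw`, ERL constants) — but
an ERL that holds only up to a power of `2` and a residual unit SUFFICES here, which is the gain over O1.
[cite: YanZhu2024MainConjNonCM, Thm. 4.7] [cite: BurungaleCastellaSkinner2025, Thm. 4.1.3]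
[cite: BurungaleSkinnerTianWan2024, §9.3.2, Prop. 9.18] -/
def SplitTwoERLCycShadow : Prop :=
  ∀ (W : WeierstrassCurve ℚ) [W.IsElliptic] [W.IsGloballyMinimal],
    ¬ W.HasCM → GoodOrd W 2 → ¬ W.HasIrreducibleModPGaloisRep 2 →
    ∀ (K : Type) [Field K] [NumberField K],
      (IsImaginaryQuadratic K ∧ SatisfiesHeegnerHypothesis (2 * W.conductorNorm ℤ) K) →
      GreenbergCycShadowAt W K → ThetaDivisibilityAt W K

/-! ## §4 The seams (kernel) -/

section Seams

variable (W : WeierstrassCurve ℚ) [W.IsElliptic] [W.IsGloballyMinimal] (K : Type) [Field K] [NumberField K]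

/-- **T1 — O2 ∧ N ⟹ O2′ at `(E,K)`** (so O2′ is WEAKER than O2 modulo the GL(1)-grade N): divisibility of the
generator by `G` restricts to the cyclotomic line as an inequality of `T`-orders (Lever 1). [folklore] -/
theorem cycShadowAt_of_lowerInclusionAt (hO2 : GreenbergLowerInclusionAt W K) (hN : GreenbergCycNondegAt W K) :
    GreenbergCycShadowAt W K := by
  intro _ ι v vbar κ₁ κ₂ γ₁ γ₂ _ _ f hf _ hv hvbar hne hemb hcyc
  obtain ⟨Ω, δ, Ωp, LK, G, hΩ, hδ, hLK, hG, htor, hdiv⟩ := hO2 ι v vbar κ₁ κ₂ γ₁ γ₂ f hf hv hvbar hne hemb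
  refine ⟨Ω, δ, Ωp, LK, G, hΩ, hδ, hLK, hG, htor, fun J hJ C hC => ?_⟩
  have hNC : shadow (toUnr₂ 2 J C) ≠ 0 := hN vbar κ₁ κ₂ γ₁ γ₂ hcyc hvbar J C hC
  have hle : Ideal.span {toUnr₂ 2 J C} ≤ Ideal.span {G} := by
    have h := hdiv J hJ
    rw [hC, Ideal.map_span, Set.image_singleton] at h
    exact h
  exact ⟨hNC, shadow_ne_zero_and_order_le_of_span_le hle hNC⟩

/-- **T2 — R0T ∧ Rres ∧ N ⟹ O2′ at `(E,K)`, with NO upper inclusion** (Lever 2): the residual divisor equality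
restricts to the cyclotomic line as an EQUALITY of `T`-orders; U (Beilinson–Flach at `2`), the `∀`-line finiteness,
the anticyclotomic `μ = 0`, Gauss rigidity and the frame normalisation are not used. [folklore] -/
theorem cycShadowAt_of_residualEquality (hR0 : GreenbergFrameTorsionAt W K)
    (hR : GreenbergResidualEqualityForallAt W K) (hN : GreenbergCycNondegAt W K) :
    GreenbergCycShadowAt W K := by
  intro _ ι v vbar κ₁ κ₂ γ₁ γ₂ _ _ f hf _ hv hvbar hne hemb hcyc
  obtain ⟨Ω, δ, Ωp, LK, G, hΩ, hδ, hLK, hG, htor⟩ := hR0 ι v vbar κ₁ κ₂ γ₁ γ₂ f hf hv hvbar hne hemb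
  refine ⟨Ω, δ, Ωp, LK, G, hΩ, hδ, hLK, hG, htor, fun J hJ C hC => ?_⟩
  have hNC : shadow (toUnr₂ 2 J C) ≠ 0 := hN vbar κ₁ κ₂ γ₁ γ₂ hcyc hvbar J C hC
  obtain ⟨_, hspan⟩ := hR ι v vbar κ₁ κ₂ γ₁ γ₂ f hf hv hvbar hne hemb Ω δ Ωp LK G hΩ hδ hLK hG J hJ C hC
  obtain ⟨hG0, hord⟩ := shadow_ne_zero_and_order_eq_of_span_red_eq hspan hNC
  exact ⟨hNC, hG0, hord.le⟩

/-- **T2⁼ — under R0T ∧ Rres ∧ N the shadow orders are EQUAL** (the exact residual identity on the cyclotomic line,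
recorded for the census: the node loses nothing by dropping U). [folklore] -/
theorem shadow_order_eq_of_residualEquality (hR : GreenbergResidualEqualityForallAt W K)
    (hN : GreenbergCycNondegAt W K) [IsCMField K] (ι : PadicAlgCl 2 ≃+* ℂ) (v vbar : HeightOneSpectrum (𝓞 K))
    (κ₁ κ₂ : ZpExtension K 2) (γ₁ γ₂ : absoluteGaloisGroup K) [Fact (ZpExtension.IsTopGeneratorPair κ₁ κ₂ γ₁ γ₂)]
    [NeZero (W.conductorNorm ℤ)] (f : CuspForm (Gamma0 (W.conductorNorm ℤ)) 2) (hf : ModularForms.IsNewformOf W f)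
    [NeZero (NumberField.discr K).natAbs] (hv : ((2 : ℕ) : 𝓞 K) ∈ v.asIdeal)
    (hvbar : ((2 : ℕ) : 𝓞 K) ∈ vbar.asIdeal) (hne : vbar ≠ v)
    (hemb : ∀ (w : InfinitePlace K) (k : 𝓞 K), k ∈ v.asIdeal ↔ ‖ι.symm (w.embedding (k : K))‖ < 1)
    (hcyc : κ₁.IsCyclotomic) (Ω δ : ℂ) (Ωp : (unrIntegers 2)ˣ) (LK G : A₂) (hΩ : Ω ≠ 0)
    (hδ : δ ^ 2 = (NumberField.discr K : ℂ) ∨ δ ^ 2 = -(NumberField.discr K : ℂ))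
    (hLK : IsKatzMeasure₂ ι v vbar ∅ κ₁ κ₂ γ₁⁻¹ γ₂⁻¹ 1 Ω δ ((Ωp : unrIntegers 2) : ℂ_[2]) LK)
    (hG : IsGreenbergLFunctionFree₂ ι v vbar κ₁ κ₂ γ₁⁻¹ γ₂⁻¹ f (NumberField.discr K).natAbs
      (NumberField.classNumber K) LK G)
    (J : ℤ_[2] →+* PadicComplexInt 2)
    (hJ : ∀ x : ℤ_[2], ((J x : PadicComplexInt 2) : ℂ_[2]) = ((x : ℚ_[2]) : ℂ_[2]))
    (C : IwasawaAlgebra₂ 2)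
    (hC : WeierstrassCurve.XGr₂.charIdeal (W.baseChange K) 2 κ₁ κ₂ vbar γ₁ γ₂ = Ideal.span {C}) :
    shadow G ≠ 0 ∧ (shadow G).order = (shadow (toUnr₂ 2 J C)).order := by
  have hNC : shadow (toUnr₂ 2 J C) ≠ 0 := hN vbar κ₁ κ₂ γ₁ γ₂ hcyc hvbar J C hC
  obtain ⟨_, hspan⟩ := hR ι v vbar κ₁ κ₂ γ₁ γ₂ f hf hv hvbar hne hemb Ω δ Ωp LK G hΩ hδ hLK hG J hJ C hC
  exact shadow_ne_zero_and_order_eq_of_span_red_eq hspan hNC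

end Seams

/-- **O2 ∧ N ⟹ O2′ on the habitat** — the registered crux (item 24728) together with N gives the shadow; the EVIDENCE
that O2′ is a WEAKER replacement. [folklore] -/
theorem cycShadowLowerAtTwo_of_bdp (hO2 : BDPSelmerLowerDivisibilityAtTwo) (hN : CycNondegAtTwo) :
    CycShadowLowerAtTwo := by
  intro W _ _ hCM hGO hβ K _ _ hK
  exact cycShadowAt_of_lowerInclusionAt W K (hO2 W hCM hGO hβ K hK) (hN W hCM hGO hβ K hK)

/-- **R0T ∧ Rres ∧ N ⟹ O2′ on the habitat** — the U-FREE node. [folklore] -/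
theorem cycShadowLowerAtTwo_of_residualEquality (hR0 : TwoVariableFrameTorsionAtTwo)
    (hR : TwoVariableResidualEqualityForallAtTwo) (hN : CycNondegAtTwo) : CycShadowLowerAtTwo := by
  intro W _ _ hCM hGO hβ K _ _ hK
  exact cycShadowAt_of_residualEquality W K (hR0 W hCM hGO hβ K hK) (hR W hCM hGO hβ K hK) (hN W hCM hGO hβ K hK)

/-- **The resplit consumer seam: O1′ ∧ O2′ ⟹ 6‴** (`ThetaShapiroGreenbergDivisibilityAtTwo`, the unique consumer of
O1 ∧ O2; binder shuffling exactly as `thetaShapiroGreenbergDivisibilityAtTwo_of_bdp`). [folklore] -/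
theorem thetaShapiroGreenbergDivisibilityAtTwo_of_cycShadow (h₁ : SplitTwoERLCycShadow)
    (h₂ : CycShadowLowerAtTwo) : ThetaShapiroGreenbergDivisibilityAtTwo := by
  intro W _ _ hCM hGO hβ κ γ hκ hγ hγ' hord _ f hf D L₀ hL₀ K _ _ hK
  exact h₁ W hCM hGO hβ K hK (h₂ W hCM hGO hβ K hK) κ γ hκ hγ hγ' hord f hf D L₀ hL₀

/-- **6‴ from the U-free node**: O1′ ∧ R0T ∧ Rres ∧ N ⟹ 6‴ — no two-variable upper inclusion anywhere.
[folklore] -/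
theorem thetaShapiroGreenbergDivisibilityAtTwo_of_residualEquality (h₁ : SplitTwoERLCycShadow)
    (hR0 : TwoVariableFrameTorsionAtTwo) (hR : TwoVariableResidualEqualityForallAtTwo) (hN : CycNondegAtTwo) :
    ThetaShapiroGreenbergDivisibilityAtTwo :=
  thetaShapiroGreenbergDivisibilityAtTwo_of_cycShadow h₁ (cycShadowLowerAtTwo_of_residualEquality hR0 hR hN)

/-- **Cost transparency: O1′ ∧ N ⟹ O1** (item 24727) — the resplit moves no difficulty INTO the bridge beyond N:
whoever proves O1′ has proved O1 on the N-locus. [folklore] -/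
theorem splitTwoExplicitReciprocityLawBDP_of_cycShadow (h₁ : SplitTwoERLCycShadow) (hN : CycNondegAtTwo) :
    SplitTwoExplicitReciprocityLawBDP := by
  intro W _ _ hCM hGO hβ K _ _ hK hO2
  exact h₁ W hCM hGO hβ K hK (cycShadowAt_of_lowerInclusionAt W K hO2 (hN W hCM hGO hβ K hK))

/-- **The registered seam is recovered**: O1′ ∧ N ∧ O2 ⟹ 6‴ (sanity: the node is a genuine weakening of the
registered pair on the N-locus, not a different target). [folklore] -/
theorem thetaShapiroGreenbergDivisibilityAtTwo_of_cycShadow_of_bdp (h₁ : SplitTwoERLCycShadow)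
    (hN : CycNondegAtTwo) (hO2 : BDPSelmerLowerDivisibilityAtTwo) : ThetaShapiroGreenbergDivisibilityAtTwo :=
  thetaShapiroGreenbergDivisibilityAtTwo_of_bdp (splitTwoExplicitReciprocityLawBDP_of_cycShadow h₁ hN) hO2

end Summit.BirchSwinnertonDyer.BirchSwinnertonDyer.Cruxes.BDPSelmerLowerDivisibilityAtTwo.CyclotomicShadowTwo

end
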